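import Literature.Topology.PlaneTopology.PlusCrossing
import HarnessLib

/-!
# Crossing a window near the unit circle: a continuum spanning an angular window screens the arc
# behind it

Topic `Literature/Topology/PlaneTopology` (consequences of the rectangle crossing lemma
`inter_nonempty_of_crossing_continua`). The following configuration occurs in the proof of
G. F. Lawler, O. Schramm, W. Werner, *Conformal invariance of planar loop-erased random walks and
uniform spanning trees*, Ann. Probab. 32 (2004), Prop. 2.2 (§5.2), when the image under the
Riemann map of a lattice path `J` runs close to the unit circle across an angular window about a
boundary point `c`, `|c| = 1`, and one wants to know that a curve starting above `J` inside the
window cannot reach the circle inside the window without meeting `J` ("`W` separates … from `u`").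

We use the chart `χ(ζ) = (im (ζ c̄), |ζ|)` — tangential coordinate and modulus — which is
continuous on `ℂ` and injective on the half-plane `{re (ζ c̄) > 0}` (no argument function is
needed), and prove:

* `window_crossing` — let `Γ` be a continuum inside the open unit disc, in the half-plane
  `{re (ζ c̄) > 0}`, reaching tangential coordinate `≤ a` and `≥ b`, with modulus `≥ lo`
  everywhere and `> m` at its points with tangential coordinate in `[a, b]`; let `L` be a
  preconnected set whose closure lies in the window `{a ≤ im (ζ c̄) ≤ b, lo ≤ |ζ| ≤ 1}` and in the
  half-plane, contains a point of modulus `1`, while `L` contains a point `ζ₀` of modulus `≤ m`.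
  Then `Γ` meets the closure of `L`. (Transport by `χ` to the rectangle `[a, b] × [lo, 1]`: a
  sub-continuum of `χ(Γ)` crosses it from left to right, `χ(closure L)` extended by the vertical
  segment below `χ(ζ₀)` crosses it from bottom to top; the common point is not on the added
  segment because there the height is `≤ m`.)

Everything is proved; no named fact.

## References

* G. F. Lawler, O. Schramm, W. Werner, Ann. Probab. 32 (2004) 939–995, §5.2 [LawlerSchrammWerner2004].
* B. Bollobás, O. Riordan, *Percolation* (2006), Ch. 7 (crossing continua) [BollobasRiordan2006].
-/

noncomputable section

namespace Literature.Topology.PlaneTopology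

open Complex Set Metric Filter _root_.Topology

/-! ### The chart `χ(ζ) = (im (ζ c̄), |ζ|)` -/

/-- The window chart `ζ ↦ im(ζ c̄) + |ζ| i` is continuous. [folklore] -/
theorem continuous_windowChart (c : ℂ) :
    Continuous fun ζ : ℂ => (⟨(ζ * (starRingEnd ℂ) c).im, ‖ζ‖⟩ : ℂ) := by
  have h : (fun ζ : ℂ => (⟨(ζ * (starRingEnd ℂ) c).im, ‖ζ‖⟩ : ℂ)) =
      ⇑Complex.equivRealProdCLM.symm ∘ fun ζ : ℂ => ((ζ * (starRingEnd ℂ) c).im, ‖ζ‖) := by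
    funext ζ
    apply Complex.ext <;> simp [Complex.equivRealProdCLM_symm_apply]
  rw [h]
  exact Complex.equivRealProdCLM.symm.continuous.comp
    ((continuous_im.comp (continuous_id.mul continuous_const)).prodMk continuous_norm)

/-- The window chart is injective on the half-plane `{re (ζ c̄) > 0}` (`c ≠ 0`): tangential
coordinate and modulus determine `re (ζ c̄) = √(|ζ c̄|² - im(ζ c̄)²)`. [folklore] -/
theorem windowChart_injOn {c : ℂ} (hc : c ≠ 0) :
    InjOn (fun ζ : ℂ => (⟨(ζ * (starRingEnd ℂ) c).im, ‖ζ‖⟩ : ℂ)) {ζ | 0 < (ζ * (starRingEnd ℂ) c).re} := by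
  intro ζ₁ h₁ ζ₂ h₂ h
  simp only [mem_setOf_eq] at h₁ h₂
  have him : (ζ₁ * (starRingEnd ℂ) c).im = (ζ₂ * (starRingEnd ℂ) c).im := congrArg Complex.re h
  have hnorm : ‖ζ₁‖ = ‖ζ₂‖ := congrArg Complex.im h
  set w₁ := ζ₁ * (starRingEnd ℂ) c with hw₁
  set w₂ := ζ₂ * (starRingEnd ℂ) c with hw₂
  have hwn : ‖w₁‖ = ‖w₂‖ := by rw [hw₁, hw₂, norm_mul, norm_mul, hnorm]
  have hsq : w₁.re ^ 2 = w₂.re ^ 2 := by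
    have e1 : ‖w₁‖ ^ 2 = w₁.re ^ 2 + w₁.im ^ 2 := by
      rw [Complex.sq_norm, Complex.normSq_apply]; ring
    have e2 : ‖w₂‖ ^ 2 = w₂.re ^ 2 + w₂.im ^ 2 := by
      rw [Complex.sq_norm, Complex.normSq_apply]; ring
    have : ‖w₁‖ ^ 2 = ‖w₂‖ ^ 2 := by rw [hwn]
    rw [e1, e2, him] at this
    linarith
  have hre : w₁.re = w₂.re := by
    have hprod : (w₁.re - w₂.re) * (w₁.re + w₂.re) = 0 := by ring_nf; linarith
    rcases mul_eq_zero.1 hprod with h0 | h0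
    · linarith
    · linarith
  have hw : w₁ = w₂ := Complex.ext hre him
  have hcc : (starRingEnd ℂ) c ≠ 0 := by simpa using hc
  exact mul_right_cancel₀ hcc hw

/-! ### The window crossing lemma -/

/-- **A continuum spanning an angular window near the circle screens the arc behind it.** Let
`c ≠ 0`, `a ≤ b`, `lo ≤ 1`. Let `Γ` be compact and preconnected, inside the open unit disc and the
half-plane `{re(ζ c̄) > 0}`, with a point of tangential coordinate `im(ζ c̄) ≤ a` and one `≥ b`,
of modulus `≥ lo` everywhere and `> m` at its points with tangential coordinate in `[a, b]`. Let
`L` be preconnected, with closure inside the window `{a ≤ im(ζ c̄) ≤ b, lo ≤ |ζ| ≤ 1}` and the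
half-plane, containing in its closure a point of modulus `1`, and containing a point `ζ₀` of
modulus `≤ m`. Then `Γ ∩ closure L ≠ ∅`. [cite: BollobasRiordan2006, Ch. 7 Claim 19 p. 192] -/
theorem window_crossing {c : ℂ} (hc : c ≠ 0) {a b lo m : ℝ} (hab : a ≤ b) (hlo : lo ≤ 1)
    {Γ : Set ℂ} (hΓc : IsCompact Γ) (hΓp : IsPreconnected Γ) (hΓ1 : ∀ ζ ∈ Γ, ‖ζ‖ < 1)
    (hΓre : ∀ ζ ∈ Γ, 0 < (ζ * (starRingEnd ℂ) c).re)
    (hΓa : ∃ ζ ∈ Γ, (ζ * (starRingEnd ℂ) c).im ≤ a) (hΓb : ∃ ζ ∈ Γ, b ≤ (ζ * (starRingEnd ℂ) c).im)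
    (hΓlo : ∀ ζ ∈ Γ, lo ≤ ‖ζ‖)
    (hΓm : ∀ ζ ∈ Γ, a ≤ (ζ * (starRingEnd ℂ) c).im → (ζ * (starRingEnd ℂ) c).im ≤ b → m < ‖ζ‖)
    {L : Set ℂ} (hLp : IsPreconnected L) (hLre : ∀ ζ ∈ closure L, 0 < (ζ * (starRingEnd ℂ) c).re)
    (hLwin : ∀ ζ ∈ closure L, a ≤ (ζ * (starRingEnd ℂ) c).im ∧ (ζ * (starRingEnd ℂ) c).im ≤ b ∧
      lo ≤ ‖ζ‖ ∧ ‖ζ‖ ≤ 1)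
    (hLtop : ∃ ζ ∈ closure L, ‖ζ‖ = 1) {ζ₀ : ℂ} (hζ₀ : ζ₀ ∈ L) (hζ₀m : ‖ζ₀‖ ≤ m) :
    ∃ ζ ∈ Γ, ζ ∈ closure L := by
  set χ : ℂ → ℂ := fun ζ : ℂ => (⟨(ζ * (starRingEnd ℂ) c).im, ‖ζ‖⟩ : ℂ) with hχ
  have hχc : Continuous χ := continuous_windowChart c
  have hχre : ∀ ζ, (χ ζ).re = (ζ * (starRingEnd ℂ) c).im := fun ζ => rfl
  have hχim : ∀ ζ, (χ ζ).im = ‖ζ‖ := fun ζ => rfl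
  -- the left–right continuum: a sub-continuum of `χ(Γ)` inside the strip `a ≤ re ≤ b`
  have hKΓc : IsCompact (χ '' Γ) := hΓc.image hχc
  have hKΓp : IsPreconnected (χ '' Γ) := hΓp.image χ hχc.continuousOn
  have hKΓa : ∃ z ∈ χ '' Γ, z.re ≤ a := by
    obtain ⟨ζ, hζ, h⟩ := hΓa
    exact ⟨χ ζ, mem_image_of_mem χ hζ, by rwa [hχre]⟩
  have hKΓb : ∃ z ∈ χ '' Γ, b ≤ z.re := by
    obtain ⟨ζ, hζ, h⟩ := hΓb
    exact ⟨χ ζ, mem_image_of_mem χ hζ, by rwa [hχre]⟩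
  obtain ⟨K, hKsub, hKc, hKp, hKstrip, hKa, hKb⟩ :=
    exists_subcontinuum_between_lines hab hKΓc hKΓp hKΓa hKΓb
  have hKrect : K ⊆ Icc a b ×ℂ Icc lo 1 := by
    intro z hz
    obtain ⟨γ, hγ, rfl⟩ := hKsub hz
    rw [mem_reProdIm, hχre, hχim]
    exact ⟨hKstrip _ hz, (hΓlo γ hγ), (hΓ1 γ hγ).le⟩
  -- the bottom–top continuum: `χ(closure L)` with the vertical segment below `χ ζ₀`
  have hζ₀c : ζ₀ ∈ closure L := subset_closure hζ₀
  have hLbdd : closure L ⊆ closedBall (0 : ℂ) 1 := fun ζ hζ =>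
    mem_closedBall_zero_iff.2 (hLwin ζ hζ).2.2.2
  have hLcpt : IsCompact (closure L) := (isCompact_closedBall (0 : ℂ) 1).of_isClosed_subset
    isClosed_closure hLbdd
  set P₀ : ℂ := χ ζ₀ with hP₀
  set P₁ : ℂ := (⟨(ζ₀ * (starRingEnd ℂ) c).im, lo⟩ : ℂ) with hP₁
  set Lset : Set ℂ := χ '' closure L ∪ segment ℝ P₀ P₁ with hLset
  have hsegc : IsCompact (segment ℝ P₀ P₁) := by
    rw [segment_eq_image']
    exact isCompact_Icc.image (by fun_prop)
  have hLsetc : IsCompact Lset := (hLcpt.image hχc).union hsegc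
  have hP₀L : P₀ ∈ χ '' closure L := mem_image_of_mem χ hζ₀c
  have hLsetp : IsPreconnected Lset :=
    (hLp.closure.image χ hχc.continuousOn).union P₀ hP₀L (left_mem_segment ℝ P₀ P₁)
      (convex_segment P₀ P₁).isPreconnected
  have hlo₀ : lo ≤ ‖ζ₀‖ := (hLwin ζ₀ hζ₀c).2.2.1
  have hrect_convex : Convex ℝ (Icc a b ×ℂ Icc lo 1) := convex_Icc_reProdIm_Icc a b lo 1
  have hP₀rect : P₀ ∈ Icc a b ×ℂ Icc lo 1 := by
    obtain ⟨h1, h2, h3, h4⟩ := hLwin ζ₀ hζ₀c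
    rw [hP₀, mem_reProdIm, hχre, hχim]
    exact ⟨⟨h1, h2⟩, h3, h4⟩
  have hP₁rect : P₁ ∈ Icc a b ×ℂ Icc lo 1 := by
    obtain ⟨h1, h2, -, -⟩ := hLwin ζ₀ hζ₀c
    rw [hP₁, mem_reProdIm]
    exact ⟨⟨h1, h2⟩, le_rfl, hlo⟩
  have hLsetrect : Lset ⊆ Icc a b ×ℂ Icc lo 1 := by
    rintro z (⟨ζ, hζ, rfl⟩ | hz)
    · obtain ⟨h1, h2, h3, h4⟩ := hLwin ζ hζ
      rw [mem_reProdIm, hχre, hχim]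
      exact ⟨⟨h1, h2⟩, h3, h4⟩
    · exact hrect_convex.segment_subset hP₀rect hP₁rect hz
  have hLsetlo : ∃ z ∈ Lset, z.im = lo := ⟨P₁, Or.inr (right_mem_segment ℝ P₀ P₁), rfl⟩
  have hLsettop : ∃ z ∈ Lset, z.im = 1 := by
    obtain ⟨ζ, hζ, hζ1⟩ := hLtop
    exact ⟨χ ζ, Or.inl (mem_image_of_mem χ hζ), by rw [hχim, hζ1]⟩
  -- the crossing point
  obtain ⟨P, hPK, hPL⟩ := inter_nonempty_of_crossing_continua hab hlo hKc hKp hKrect hKa hKb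
    hLsetc hLsetp hLsetrect hLsetlo hLsettop
  obtain ⟨γ, hγ, hγP⟩ := hKsub hPK
  have hγab : a ≤ (γ * (starRingEnd ℂ) c).im ∧ (γ * (starRingEnd ℂ) c).im ≤ b := by
    have := hKstrip P hPK
    rwa [← hγP, hχre] at this
  have hγm : m < ‖γ‖ := hΓm γ hγ hγab.1 hγab.2
  rcases hPL with ⟨ℓ, hℓ, hℓP⟩ | hPseg
  · -- `P = χ ℓ`, `ℓ ∈ closure L`: injectivity of the chart
    have heq : γ = ℓ := windowChart_injOn hc (hΓre γ hγ) (hLre ℓ hℓ) (hγP.trans hℓP.symm)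
    exact ⟨γ, hγ, heq ▸ hℓ⟩
  · -- on the added segment the height is `≤ ‖ζ₀‖ ≤ m < ‖γ‖ = P.im`: impossible
    exfalso
    rw [segment_eq_image'] at hPseg
    obtain ⟨t, ⟨ht0, ht1⟩, hPt⟩ := hPseg
    have hPim : P.im = ‖ζ₀‖ + t * (lo - ‖ζ₀‖) := by
      rw [← hPt]
      simp [hP₀, hP₁, hχ]
    have hPim' : P.im = ‖γ‖ := by rw [← hγP, hχim]
    have : t * (lo - ‖ζ₀‖) ≤ 0 := mul_nonpos_of_nonneg_of_nonpos ht0 (by linarith)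
    linarith

end Literature.Topology.PlaneTopology

end
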